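import Summits.ABC.IUTFork.Conditional.AbcOfSGenuineKTameShallowInhabited
import HarnessLib

/-!
# Branch C / R-W lane P+: the INHABITED side at GENUINE data, pole order up to `4` (`v_p ≤ 2`) — at an all-lattice-tame datum whose bad
# places have `e(w|v)·ord_v(q_v) ≤ 4·e(w|p)` and `e(w|p) ≥ l` the hull-level clause S_H HOLDS (chosen ideles, pinned reading)

PROOF-ONLY file (no `def`, no new `Prop`, no instance) of the abc-iut cell (WAVE-4 prover seat abc-iut-w4-d107, gen 6; D-0079 R-W «WINDOW
Θ-SIDE INEQUALITY», row «W:TAME-SHALLOW-INHABITED», lane P+; sequel of `AbcOfSGenuineKTameShallowInhabited` p466297). TAKES NO SIDE on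
[IUTchIII] Cor. 3.12 (S. Mochizuki, *Inter-universal Teichmüller theory III*, Cor. 3.12 p. 173–174, Step (xi-f) p. 184) or on any author. Same
engine (abc-iut-w4-d006's exact pair predicate at all-tame genuine `K`-level data, `Cor312Prov.licence_settingPrVolSharp_pilotDataOfK_iff_of_tame_pairs`),
inhabited side, with the pole-order hypothesis RELAXED from `2` to `4` at the price of the label range `j ≤ l⋆ = (l−1)/2` (exactly the labels the
predicate quantifies) and the Kummer-type input `e(w|p) ≥ l` at the bad places (which at rational points follows from `2l·P_w = e(w|p)·h_p` with
`h_p ≤ 4 < l`, sequel file).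

WHAT IS PROVED.
* §1 `TameShallow.pair_test_two` — for integers `1 ≤ j`, `2j + 1 ≤ l`, `P_w ≥ 1`, **`l·P_w ≤ 2·e_w`**, **`l ≤ e_y`**: the pair inequality
  `e_y·(e_w·min((j²P_w − 1)/e_w, (j²P_y − 1)/e_y) + 1) ≤ e_y·P_w + j·e_w·(e_y − 1)` HOLDS (`e_w·min ≤ j²P_w − 1`, then
  `2e_y(j²−1)P_w ≤ j·l·P_w·(e_y−1) ≤ 2j·e_w·(e_y−1)` from `e_y(j(l−2j)+2) ≥ l(j+2) ≥ jl`).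
* §2 GENUINE `K`-datum `X := Cor312Prov.pilotDataOfK D K`, CHOSEN realising ideles, every choice of the free context binders and Kummer datum: all places
  over bad primes lattice-tame, every bad place `w` with `e(w|v)·ord_v(q_v) ≤ 4·e(w|p)` and `l ≤ e(w|p)` ⟹ **`GenuineK.licence_chosen_of_tame_shallow_two_two`**,
  **`GenuineK.pilotKummerCompatHull_chosen_of_tame_shallow_two_two`** (the per-datum object of `hSHw`/`hSHwBad` HOLDS), **`GenuineK.statement_chosen_of_tame_shallow_two_two`**.
READING (numbers, not adjectives): with abc-iut-w5-d107's ROBUST refuted side (`2l ≤ i₀·h` at a lattice-tame bad place ⇒ ¬S_H; top label: `4l ≤ (l−3)·h`,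
i.e. `v_p ≥ 3` for every prime `l ≥ 11`) this gives, at all-lattice-tame genuine data over rational points and `l ≥ 11`, an EXACT DICHOTOMY of the typed
clause by the integer `max_p v_p` (`≤ 2` INHABITED, `≥ 3` REFUTED) — sequel `AbcOfSGenuineKTameShallowInhabitedTwoRatPoint.lean`. HONEST SCOPE as in the
parent: SHARP reading; OUR containers; STRONGER-THAN-PRINT licence; admissibility and NON-EMPTINESS of the datum types NOT claimed; «inhabited as typed» ≠
«true in print»; typed ≠ proved; instantiated ≠ endorsed; no abc claim. [cite: Mochizuki2012, IUTchIII Cor. 3.12 p. 173–174, Step (xi-f) p. 184;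
IUTchI Def. 3.1 (b),(c) p. 61, Ex. 3.2 (iv) p. 71; IUTchIV Prop. 1.1 p. 9] [cite: DupuyHilado2025, §3.3, §3.4, §3.9, §4.9]
[claim: Mochizuki2012, status: disputed] for every IUT sentence quoted.
-/
noncomputable section

open Set Function NumberField IsDedekindDomain

/-! ## §1. The integer lemma, pole order up to `4`: `l·P_w ≤ 2e_w`, `e_y ≥ l`, labels `j ≤ l⋆` -/

namespace Summit.ABC.IUTFork.Conditional.TameShallow

/-- **Inhabited side of the exact tame pair predicate, pole order `≤ 4`.** For integers `1 ≤ j`, `2j + 1 ≤ l`, `P_w ≥ 1`, `l·P_w ≤ 2·e_w`, `l ≤ e_y`: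
`e_y·(e_w·min((j²P_w − 1)/e_w, (j²P_y − 1)/e_y) + 1) ≤ e_y·P_w + j·e_w·(e_y − 1)` (integer division). [folklore] -/
theorem pair_test_two {l j ew ey Pw Py : ℤ} (hj1 : 1 ≤ j) (hjl : 2 * j + 1 ≤ l) (hPw : 1 ≤ Pw)
    (hw : l * Pw ≤ 2 * ew) (hy : l ≤ ey) :
    ey * (ew * min ((j ^ 2 * Pw - 1) / ew) ((j ^ 2 * Py - 1) / ey) + 1) ≤ ey * Pw + j * ew * (ey - 1) := by
  have hl : 3 ≤ l := by omega
  have hew : 1 ≤ ew := by nlinarith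
  have hD : ew * ((j ^ 2 * Pw - 1) / ew) ≤ j ^ 2 * Pw - 1 := Int.mul_ediv_self_le (by omega)
  have hmin : min ((j ^ 2 * Pw - 1) / ew) ((j ^ 2 * Py - 1) / ey) ≤ (j ^ 2 * Pw - 1) / ew := min_le_left _ _
  have h1 : ew * min ((j ^ 2 * Pw - 1) / ew) ((j ^ 2 * Py - 1) / ey) ≤ j ^ 2 * Pw - 1 :=
    (mul_le_mul_of_nonneg_left hmin (by omega)).trans hD
  have h2 : ey * (ew * min ((j ^ 2 * Pw - 1) / ew) ((j ^ 2 * Py - 1) / ey) + 1) ≤ ey * (j ^ 2 * Pw) :=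
    mul_le_mul_of_nonneg_left (by linarith) (by omega)
  -- `2·e_y·(j² − 1) ≤ j·l·(e_y − 1)` from `e_y ≥ l`, `j(l − 2j) + 2 ≥ j + 2`
  have h5 : j + 2 ≤ j * l - 2 * j ^ 2 + 2 := by nlinarith
  have h6 : l * (j + 2) ≤ ey * (j * l - 2 * j ^ 2 + 2) :=
    calc l * (j + 2) ≤ ey * (j + 2) := mul_le_mul_of_nonneg_right hy (by omega)
      _ ≤ ey * (j * l - 2 * j ^ 2 + 2) := mul_le_mul_of_nonneg_left h5 (by omega)
  have h4 : 2 * (ey * (j ^ 2 - 1)) ≤ j * l * (ey - 1) := by nlinarith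
  -- multiply by `P_w ≥ 0` and use `2e_w ≥ l·P_w`
  have h7 : 2 * (ey * (j ^ 2 - 1)) * Pw ≤ j * l * (ey - 1) * Pw := mul_le_mul_of_nonneg_right h4 (by omega)
  have h8 : j * (l * Pw) * (ey - 1) ≤ j * (2 * ew) * (ey - 1) :=
    mul_le_mul_of_nonneg_right (mul_le_mul_of_nonneg_left hw (by omega)) (by omega)
  nlinarith

end Summit.ABC.IUTFork.Conditional.TameShallow

/-! ## §2. The GENUINE `K`-datum with the CHOSEN realising ideles: all-tame + pole order `≤ 4` + `e(w|p) ≥ l` ⇒ Licence, S_H, Statement -/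

namespace Summit.ABC.IUTFork.Conditional

open Thm311 Thm311.Real Cor312 Cor312Vol Cor312Prov Literature.IUT.LogThetaLattice Literature.IUT.LogVolume
  Literature.IUT.HodgeTheaters Literature.IUT.LogVolume.ThetaData Literature.IUT.LogVolume.Cor22
open Literature.NumberTheory.NumberFields Literature.NumberTheory.GaloisRepresentations.Ultrametric
open Literature.NumberTheory.DiophantineGeometry.GenEll Summit.ABC.ABC.Theorems

section PerDatum

variable {F K Fbar : Type} [Field F] [NumberField F] [Field K] [NumberField K] [Algebra F K] [Field Fbar]
  [Algebra F Fbar] [Algebra K Fbar] {E : WeierstrassCurve F} [E.IsElliptic] {l : ℕ} {Pb : BadPlacePredicates K}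
  (D : InitialThetaData F K Fbar E l Pb)
  (M : Type) [Field M] [NumberField M]
  (archPk : ∀ (j : (thetaIndex (pilotDataOfK D K)).Label) (vQ : (thetaIndex (pilotDataOfK D K)).VQ), Set ((logShellsDH (pilotDataOfK D K) (analyticLogv K)).Packet j vQ))
  (archSub : ∀ (j : (thetaIndex (pilotDataOfK D K)).Label) (v : (thetaIndex (pilotDataOfK D K)).V),
    Set ((logShellsDH (pilotDataOfK D K) (analyticLogv K)).Packet j ((thetaIndex (pilotDataOfK D K)).over v)))
  (Ψ : ℤ → ∀ v : (thetaIndex (pilotDataOfK D K)).V, v ∈ (thetaIndex (pilotDataOfK D K)).Vbad → Set ((logShellsDH (pilotDataOfK D K) (analyticLogv K)).StarPacket v))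
  (act : ℤ → ∀ v : (thetaIndex (pilotDataOfK D K)).V, v ∈ (thetaIndex (pilotDataOfK D K)).Vbad →
    (logShellsDH (pilotDataOfK D K) (analyticLogv K)).StarPacket v → Module.End ℚ ((logShellsDH (pilotDataOfK D K) (analyticLogv K)).StarPacket v))
  (Mmod : ℤ → ∀ j : (thetaIndex (pilotDataOfK D K)).LabelStar, Set ((logShellsDH (pilotDataOfK D K) (analyticLogv K)).GlobalPacket j.1))
  (region : ℤ → ∀ j : (thetaIndex (pilotDataOfK D K)).LabelStar, FinDivisor M → ∀ vQ : (thetaIndex (pilotDataOfK D K)).VQ,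
    Set ((logShellsDH (pilotDataOfK D K) (analyticLogv K)).Packet j.1 vQ))
  (frobAdm : ℤ → ℤ → ∀ (j : (thetaIndex (pilotDataOfK D K)).Label) (vQ : (thetaIndex (pilotDataOfK D K)).VQ),
    Set ((logShellsDH (pilotDataOfK D K) (analyticLogv K)).Packet j vQ) → Prop)
  (frobLogvol : ℤ → ℤ → ∀ (j : (thetaIndex (pilotDataOfK D K)).Label) (vQ : (thetaIndex (pilotDataOfK D K)).VQ),
    Set ((logShellsDH (pilotDataOfK D K) (analyticLogv K)).Packet j vQ) → ℝ)
  (frobΨ : ℤ → ℤ → ∀ v : (thetaIndex (pilotDataOfK D K)).V, v ∈ (thetaIndex (pilotDataOfK D K)).Vbad → Set ((logShellsDH (pilotDataOfK D K) (analyticLogv K)).StarPacket v))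
  (frobMmod : ℤ → ℤ → ∀ j : (thetaIndex (pilotDataOfK D K)).LabelStar, Set ((logShellsDH (pilotDataOfK D K) (analyticLogv K)).GlobalPacket j.1))
  (unitImage : ℤ → ℤ → ℕ → ∀ (j : (thetaIndex (pilotDataOfK D K)).Label) (vQ : (thetaIndex (pilotDataOfK D K)).VQ),
    Set ((logShellsDH (pilotDataOfK D K) (analyticLogv K)).Packet j vQ))
  (ballImage : ℤ → ℤ → ∀ (j : (thetaIndex (pilotDataOfK D K)).Label) (vQ : (thetaIndex (pilotDataOfK D K)).VQ),
    Set ((logShellsDH (pilotDataOfK D K) (analyticLogv K)).Packet j vQ))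
  (thetaDiv : ℤ → ℤ → LgpDivisor M (thetaIndex (pilotDataOfK D K)).lstar)
  (n : ℤ) {HT : Type} {LogLink : HT → HT → Type} {IsFull : ∀ {s t : HT}, LogLink s t → Prop}
  (lat : LGPGaussianLogThetaLattice LogLink IsFull)
  {Frd : Type} {IsoF : Frd → Frd → Type} {Ob : Frd → Type} {realify : Frd → Frd} {Strip : Type}
  {IsoS : Strip → Strip → Type} {Mv : ∀ v : (thetaIndex (pilotDataOfK D K)).V, v ∈ (thetaIndex (pilotDataOfK D K)).Vbad → Type}
  [∀ v h, Monoid (Mv v h)]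
  (sig : GlobalLGPFrobenioidSignature (thetaIndex (pilotDataOfK D K)).lstar (thetaIndex (pilotDataOfK D K)).V (· ∈ (thetaIndex (pilotDataOfK D K)).Vbad)
    Frd IsoF Ob realify Strip IsoS Mv)
  (split : SplittingMonoids Mv) {ObΔ : Type} {N : ∀ v : (thetaIndex (pilotDataOfK D K)).V, v ∈ (thetaIndex (pilotDataOfK D K)).Vbad → Type}
  [∀ v h, Monoid (N v h)] (qData : QPilotData ObΔ N)
  (qK : ∀ v : (thetaIndex (pilotDataOfK D K)).V, v ∈ (thetaIndex (pilotDataOfK D K)).Vbad → Set ((logShellsDH (pilotDataOfK D K) (analyticLogv K)).StarPacket v))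

/-- **INHABITED LICENCE AT THE GENUINE `K`-DATUM, pole order `≤ 4` (chosen realising ideles).** At `X := pilotDataOfK D K`: if every place `x` of `K`
over a prime `p` below a bad place is lattice-tame (`p > 2`, `e(x|p) ≤ p − 2`) and every bad place `w | p` has **`e(w|v)·ord_v(q_v) ≤ 4·e(w|p)`** and
**`l ≤ e(w|p)`** (`2l·P_q(w) = e(w|v)·ord_v(q_v)` by abc-iut-w5-d009's `exists_nat_qPilot_pilotDataOfK`, so `l·P_q(w) ≤ 2·e(w|p)`), then abc-iut-c312-1's
(xi-f) `Licence` HOLDS at abc-iut-c312-7's `settingPrVolSharp` — the pair predicate holds at every label `j ≤ l⋆` by §1.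
[cite: Mochizuki2012, IUTchI Ex. 3.2 (iv) p. 71; IUTchIII Cor. 3.12 Step (xi-f) p. 184] [cite: DupuyHilado2025, §3.3, §3.4, §4.9]
[claim: Mochizuki2012, status: disputed] -/
theorem GenuineK.licence_chosen_of_tame_shallow_two
    (htame : ∀ (pp : Nat.Primes) (x : (thetaIndex (pilotDataOfK D K)).Fibre (.inr pp)),
      haveI : Fact (pp : ℕ).Prime := ⟨pp.2⟩
      (∃ w : (thetaIndex (pilotDataOfK D K)).Fibre (.inr pp), placeOf (pilotDataOfK D K) pp.1 w ∈ (pilotDataOfK D K).S) →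
        2 < (pp : ℕ) ∧ (placeOf (pilotDataOfK D K) pp.1 x).asIdeal.ramificationIdx ℤ ≤ (pp : ℕ) - 2)
    (hshallow : ∀ (pp : Nat.Primes) (w : (thetaIndex (pilotDataOfK D K)).Fibre (.inr pp)),
      haveI : Fact (pp : ℕ).Prime := ⟨pp.2⟩
      placeOf (pilotDataOfK D K) pp.1 w ∈ (pilotDataOfK D K).S →
        (finBelow F K (placeOf (pilotDataOfK D K) pp.1 w)).asIdeal.ramificationIdx' (placeOf (pilotDataOfK D K) pp.1 w).asIdeal *
            qParamOrd E (finBelow F K (placeOf (pilotDataOfK D K) pp.1 w)) ≤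
          4 * (placeOf (pilotDataOfK D K) pp.1 w).asIdeal.ramificationIdx ℤ ∧
        l ≤ (placeOf (pilotDataOfK D K) pp.1 w).asIdeal.ramificationIdx ℤ) :
    Thm311ToCor312.Licence
      (settingPrVolSharp (pilotDataOfK D K) (logvAnalytic_analyticLogv (F := K)) M archPk archSub Ψ act Mmod region n lat sig split qData
        (exists_realising_qIdeles_pilotDataOfK D).choose (exists_realising_thetaIdeles_pilotDataOfK D).choose
        (exists_realising_qIdeles_pilotDataOfK D).choose_spec.1 (exists_realising_qIdeles_pilotDataOfK D).choose_spec.2.1) := by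
  classical
  refine (licence_settingPrVolSharp_pilotDataOfK_iff_of_tame_pairs D (logvAnalytic_analyticLogv (F := K)) M archPk archSub Ψ act Mmod region
    n lat sig split qData (exists_realising_qIdeles_pilotDataOfK D).choose (exists_realising_thetaIdeles_pilotDataOfK D).choose
    (exists_realising_qIdeles_pilotDataOfK D).choose_spec.1 (exists_realising_qIdeles_pilotDataOfK D).choose_spec.2.1
    (exists_realising_thetaIdeles_pilotDataOfK D).choose_spec.1 (exists_realising_thetaIdeles_pilotDataOfK D).choose_spec.2.2
    (exists_realising_qIdeles_pilotDataOfK D).choose_spec.2.2 htame).mpr ?_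
  intro pp i w y hw hy Pw Py hPw hPy
  haveI : Fact (pp : ℕ).Prime := ⟨pp.2⟩
  obtain ⟨Pw', hPw', hPw1, hPweq⟩ := exists_nat_qPilot_pilotDataOfK D hw
  obtain ⟨Py', hPy', -, -⟩ := exists_nat_qPilot_pilotDataOfK D hy
  have hww : Pw' = Pw := by have := hPw'.symm.trans hPw; exact_mod_cast this
  have hyy : Py' = Py := by have := hPy'.symm.trans hPy; exact_mod_cast this
  subst hww
  subst hyy
  have h5 : 5 ≤ l := D.five_le_l
  have hlw : l * Pw' ≤ 2 * (placeOf (pilotDataOfK D K) pp.1 w).asIdeal.ramificationIdx ℤ := by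
    have h2 : 2 * (l * Pw') ≤ 4 * (placeOf (pilotDataOfK D K) pp.1 w).asIdeal.ramificationIdx ℤ := by
      rw [← mul_assoc, hPweq]
      exact (hshallow pp w hw).1
    omega
  have hly : l ≤ (placeOf (pilotDataOfK D K) pp.1 y).asIdeal.ramificationIdx ℤ := (hshallow pp y hy).2
  -- the label `j = i + 1 < l`
  have hlstar : (pilotDataOfK D K).lstar = (l - 1) / 2 := by
    show ((pilotDataOfK D K).l - 1) / 2 = (l - 1) / 2
    rw [pilotDataOfK_l]
  have hi : (i : ℕ) < (l - 1) / 2 := by rw [← hlstar]; exact i.2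
  have hjl : 2 * (((i : ℕ) + 1 : ℕ) : ℤ) + 1 ≤ (l : ℤ) := by push_cast; omega
  exact TameShallow.pair_test_two (l := (l : ℤ)) (by push_cast; omega) hjl (by exact_mod_cast hPw1)
    (by exact_mod_cast hlw) (by exact_mod_cast hly)

/-- **INHABITED S_H AT THE GENUINE `K`-DATUM, pole order `≤ 4` — an INSTANCE of the window binder's per-datum object.** Same hypotheses; conclusion: the
hull-level clause `Cor312Vol.PilotKummerCompatHull … (fun _ => qRegion) qK` at the genuine sharp setting over `K` with the CHOSEN realising
ideles and the PINNED reading — verbatim the per-datum object of `hSHw` / `hSHwBad` (p447945 / p450130 / p453137) — HOLDS, for EVERY choice of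
the free context binders and Kummer datum (the inclusion at the junk label `0` is the mover argument of abc-iut-w5-d009's
`exists_qPinned_and_hull_settingPrVolSharp_iff_licence`, the chosen q-ideles having norm `≤ 1`). «inhabited as typed» ≠ «true in print».
[cite: Mochizuki2012, IUTchIII Cor. 3.12 Step (xi-f) p. 184] [cite: DupuyHilado2025, §3.4, §4.9] [claim: Mochizuki2012, status: disputed] -/
theorem GenuineK.pilotKummerCompatHull_chosen_of_tame_shallow_two
    (htame : ∀ (pp : Nat.Primes) (x : (thetaIndex (pilotDataOfK D K)).Fibre (.inr pp)),
      haveI : Fact (pp : ℕ).Prime := ⟨pp.2⟩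
      (∃ w : (thetaIndex (pilotDataOfK D K)).Fibre (.inr pp), placeOf (pilotDataOfK D K) pp.1 w ∈ (pilotDataOfK D K).S) →
        2 < (pp : ℕ) ∧ (placeOf (pilotDataOfK D K) pp.1 x).asIdeal.ramificationIdx ℤ ≤ (pp : ℕ) - 2)
    (hshallow : ∀ (pp : Nat.Primes) (w : (thetaIndex (pilotDataOfK D K)).Fibre (.inr pp)),
      haveI : Fact (pp : ℕ).Prime := ⟨pp.2⟩
      placeOf (pilotDataOfK D K) pp.1 w ∈ (pilotDataOfK D K).S →
        (finBelow F K (placeOf (pilotDataOfK D K) pp.1 w)).asIdeal.ramificationIdx' (placeOf (pilotDataOfK D K) pp.1 w).asIdeal *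
            qParamOrd E (finBelow F K (placeOf (pilotDataOfK D K) pp.1 w)) ≤
          4 * (placeOf (pilotDataOfK D K) pp.1 w).asIdeal.ramificationIdx ℤ ∧
        l ≤ (placeOf (pilotDataOfK D K) pp.1 w).asIdeal.ramificationIdx ℤ) :
    Cor312Vol.PilotKummerCompatHull
        (LatticeSituation.ofShells (logShellsDH (pilotDataOfK D K) (analyticLogv K)) M archPk archSub
        (summandPiecesPr (pilotDataOfK D K) (logvAnalytic_analyticLogv (F := K))).Adm
        (summandPiecesPr (pilotDataOfK D K) (logvAnalytic_analyticLogv (F := K))).logvol Ψ act Mmod region frobAdm frobLogvol frobΨ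
        frobMmod unitImage ballImage thetaDiv)
        (settingPrVolSharp (pilotDataOfK D K) (logvAnalytic_analyticLogv (F := K)) M archPk archSub Ψ act Mmod region n lat sig split qData
        (exists_realising_qIdeles_pilotDataOfK D).choose (exists_realising_thetaIdeles_pilotDataOfK D).choose
        (exists_realising_qIdeles_pilotDataOfK D).choose_spec.1 (exists_realising_qIdeles_pilotDataOfK D).choose_spec.2.1)
        (fun _ => Cor312.Setting.qRegion
        (settingPrVolSharp (pilotDataOfK D K) (logvAnalytic_analyticLogv (F := K)) M archPk archSub Ψ act Mmod region n lat sig split qData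
        (exists_realising_qIdeles_pilotDataOfK D).choose (exists_realising_thetaIdeles_pilotDataOfK D).choose
        (exists_realising_qIdeles_pilotDataOfK D).choose_spec.1 (exists_realising_qIdeles_pilotDataOfK D).choose_spec.2.1)) qK := by
  classical
  have hL := GenuineK.licence_chosen_of_tame_shallow_two D M archPk archSub Ψ act Mmod region n lat sig split qData htame hshallow
  have htqle : ∀ pp x, ‖(exists_realising_qIdeles_pilotDataOfK D).choose pp x‖ ≤ 1 := fun pp x =>
    norm_qIdele_le_one_of_realises (pilotDataOfK D K) (exists_realising_qIdeles_pilotDataOfK D).choose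
      (exists_realising_qIdeles_pilotDataOfK D).choose_spec.1 (exists_realising_qIdeles_pilotDataOfK D).choose_spec.2.2 pp x
  obtain ⟨ρ, qK', hq, hh⟩ := (exists_qPinned_and_hull_settingPrVolSharp_iff_licence (pilotDataOfK D K) (logvAnalytic_analyticLogv (F := K))
    M archPk archSub Ψ act Mmod region n lat sig split qData (exists_realising_qIdeles_pilotDataOfK D).choose
    (exists_realising_thetaIdeles_pilotDataOfK D).choose (exists_realising_qIdeles_pilotDataOfK D).choose_spec.1
    (exists_realising_qIdeles_pilotDataOfK D).choose_spec.2.1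
    (col := fun m => Column.ofDivisors (logShellsDH (pilotDataOfK D K) (analyticLogv K)) M (frobAdm m) (frobLogvol m) (frobΨ m) (frobMmod m)
      (unitImage m) (ballImage m) (thetaDiv m)) htqle).mpr hL
  intro j vQ
  exact (Conditional.Antecedent.exists_qPinned_and_hull_iff _ _).mp ⟨ρ, qK', hq, hh⟩ j vQ

/-- **THE TYPED STATEMENT OF [IUTchIII] Cor. 3.12 HOLDS AT THIS GENUINE SHARP SETTING, pole order `≤ 4`** (`Cor312.Setting.Statement`, at
abc-iut-c312-7's print-normalised `settingPrVolSharp` over the GENUINE `K`-level Dupuy–Hilado datum with the chosen realising ideles): the licence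
(above) and the bridge hypotheses — every field a theorem for this setting (abc-iut-w5-d068 `bridgeHyps_settingPrVolSharp_of_ideles`, the idele side
conditions being those of the chosen realising ideles) — give the Statement by abc-iut-c312-1's `statement_of_licence`. It holds by (Ind1)-INFLATION at
shallow tame packets, NOT by the disputed inference; nothing about print is asserted. [cite: Mochizuki2012, IUTchIII Cor. 3.12 p. 173–174]
[cite: DupuyHilado2025, §3.9, §4.9] [claim: Mochizuki2012, status: disputed] -/
theorem GenuineK.statement_chosen_of_tame_shallow_two
    (htame : ∀ (pp : Nat.Primes) (x : (thetaIndex (pilotDataOfK D K)).Fibre (.inr pp)),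
      haveI : Fact (pp : ℕ).Prime := ⟨pp.2⟩
      (∃ w : (thetaIndex (pilotDataOfK D K)).Fibre (.inr pp), placeOf (pilotDataOfK D K) pp.1 w ∈ (pilotDataOfK D K).S) →
        2 < (pp : ℕ) ∧ (placeOf (pilotDataOfK D K) pp.1 x).asIdeal.ramificationIdx ℤ ≤ (pp : ℕ) - 2)
    (hshallow : ∀ (pp : Nat.Primes) (w : (thetaIndex (pilotDataOfK D K)).Fibre (.inr pp)),
      haveI : Fact (pp : ℕ).Prime := ⟨pp.2⟩
      placeOf (pilotDataOfK D K) pp.1 w ∈ (pilotDataOfK D K).S →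
        (finBelow F K (placeOf (pilotDataOfK D K) pp.1 w)).asIdeal.ramificationIdx' (placeOf (pilotDataOfK D K) pp.1 w).asIdeal *
            qParamOrd E (finBelow F K (placeOf (pilotDataOfK D K) pp.1 w)) ≤
          4 * (placeOf (pilotDataOfK D K) pp.1 w).asIdeal.ramificationIdx ℤ ∧
        l ≤ (placeOf (pilotDataOfK D K) pp.1 w).asIdeal.ramificationIdx ℤ) :
    (settingPrVolSharp (pilotDataOfK D K) (logvAnalytic_analyticLogv (F := K)) M archPk archSub Ψ act Mmod region n lat sig split qData
        (exists_realising_qIdeles_pilotDataOfK D).choose (exists_realising_thetaIdeles_pilotDataOfK D).choose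
        (exists_realising_qIdeles_pilotDataOfK D).choose_spec.1 (exists_realising_qIdeles_pilotDataOfK D).choose_spec.2.1).Statement :=
  Thm311ToCor312.statement_of_licence
    (bridgeHyps_settingPrVolSharp_of_ideles (pilotDataOfK D K) (logvAnalytic_analyticLogv (F := K)) M archPk archSub Ψ act Mmod region n
      lat sig split qData (tq := (exists_realising_qIdeles_pilotDataOfK D).choose) (t := (exists_realising_thetaIdeles_pilotDataOfK D).choose)
      (exists_realising_thetaIdeles_pilotDataOfK D).choose_spec.1 (exists_realising_thetaIdeles_pilotDataOfK D).choose_spec.2.1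
      (exists_realising_qIdeles_pilotDataOfK D).choose_spec.1 (exists_realising_qIdeles_pilotDataOfK D).choose_spec.2.1)
    (GenuineK.licence_chosen_of_tame_shallow_two D M archPk archSub Ψ act Mmod region n lat sig split qData htame hshallow)

end PerDatum

end Summit.ABC.IUTFork.Conditional

end
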